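import Literature.AlgebraicGeometry.AbelianSchemes.LDeltaCubeLocus
import Literature.AlgebraicGeometry.AbelianSchemes.HomFactorsThroughMulNBaseChange
import Literature.AlgebraicGeometry.AbelianSchemes.PolarizationLevelBaseQuotientDescent
import Literature.AlgebraicGeometry.AbelianSchemes.PolarizedAbelianSchemeWithLevelBaseChange
import Literature.AlgebraicGeometry.AbelianSchemes.AbelianSchemeDualTransportOfBaseChange
import Literature.AlgebraicGeometry.AbelianSchemes.AbelianSchemeOverFibreIdentity
import Literature.AlgebraicGeometry.AbelianSchemes.LevelStructureTransportIso
import HarnessLib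

/-!
# The sixth root of `Λ(L)` base-changes: the clauses of [MFK94] Prop. 7.3 on `(A ×_S S₁) ×_{S₁} T` and on `A ×_S T`
# agree ([MumfordFogartyKirwan1994] Ch. 6 §2 Prop. 6.11 (uniqueness); Ch. 7 §2 Def. 7.2, Prop. 7.3)

Topic `AlgebraicGeometry/AbelianSchemes`; namespace `Literature.AlgebraicGeometry.AbelianSchemes.AbelianSchemeOver`.
THEOREMS ONLY (no definition, no named fact, no instance, no notation, no `sorry`; net Literature debt 0).  Cell
hodgecm-mathlib (D-0151), F-DAG of the input (F) «Siegel fine moduli scheme», seam (S2) of the capstone (B-p02 (g14)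
2026-08-30T08:50:00Z): the ONE abelian-level seam between the locus tower ★ `PolarizedLevelLocusTower` (whose storeys over
`H₅` speak about `(A ×_S H₅) ×_{H₅} T`) and the `b`-intrinsic clauses of the capstone (which speak about `A ×_S T`,
`b = v ≫ j₅`).  HC_CM is proved only modulo the 7 printed citations until rung 0 closes; this file discharges none of them.

SETTING.  `A → S` an abelian scheme, `D = (Â, 𝒫)` a dual pair, `lam = Λ(L) : A → Â`, `6` invertible in the residue
fields of `S`; `j : S₁ → S`, `v : T → S₁`, `b = v ≫ j`; polarisations `pol₁` of `(A, D) ×_S S₁` and `pol` of `(A, D) ×_S T`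
with `[6] ≫ pol₁.lam = Λ(L)_{S₁}`, `[6] ≫ pol.lam = Λ(L)_T`.  By [MumfordFogartyKirwan1994] Prop. 6.11 the sixth root of
`Λ(L)_T` is UNIQUE (★ `descended_hom_unique`), and the transport of `pol₁.lam ×_{S₁} T` along the comparison of group
schemes `E : A ×_S T ≅ (A ×_S S₁) ×_{S₁} T` (★ `baseChangeCompGrpIso`) is a sixth root (★ `pow_id_comp_transport`); so
`(E, Ê)` intertwine `pol₁ ×_{S₁} T` with `pol`, the Poincaré sheaves and the pulled-back sections — an `IsBaseChangeVia`
datum along `𝟙 T` — and ★ `PolarizationLevelBaseQuotientDescent` §3/§5 (at `p = 𝟙 T`) moves the clauses both ways.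
* §1 `baseChange_baseChange_isBaseChangeVia_id`, `baseChange_comp_isBaseChangeVia_id` (also for `Â` via `D.hat`),
  **`sectionBaseChange_sectionBaseChange_comp_baseChangeCompGrpIso_inv`** (`(τ ×_S S₁) ×_{S₁} T ↦ τ ×_S T`).
* §2 **`pullback_map_lam_eq_transport_of_pow_six_comp_eq`**: `(pol₁ ×_{S₁} T).lam = E⁻¹ ≫ pol.lam ≫ Ê`, and its two
  `hcomm` readings on underlying schemes.
* §3 the Poincaré clauses `(E⁻¹ × Ê⁻¹)^* 𝒫_T ≅ (𝒫_{S₁})_T`, `(E × Ê)^* (𝒫_{S₁})_T ≅ 𝒫_T` (composition and comparison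
  of ★ `DualPair.nonempty_pullback_map_P_iso_baseChange_P`, ★ `DualPair.nonempty_pullback_map_comp_iso`).
* §4 **`Polarization.hasType_baseChange_iff_of_pow_six_comp_eq`**, **`LevelStructure.isSymplecticLiftable_iff_of_pow_six_comp_eq`**,
  **`LevelStructure.exists_baseChange_baseChange_iff`**, **`LevelStructure.exists_isSymplecticLiftable_iff_of_pow_six_comp_eq`**,
  HEAD **`hasType_iff_and_exists_isSymplecticLiftable_iff_of_pow_six_comp_eq`** (= the capstone's `hS2` letter): the
  clauses of ★ `exists_isImmersion_iff_existsUnique_symplecticLevel` for `(A ×_S S₁, pol₁, σ ×_S S₁)` at `v` iff the same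
  clauses for `(A ×_S T, pol, σ ×_S T)`.

## References
* [MumfordFogartyKirwan1994] D. Mumford, J. Fogarty, F. Kirwan, *Geometric Invariant Theory*, 3rd ed. (1994), Ch. 6 §2
  Prop. 6.11 (p. 122; proof pp. 122–123), §1 Cor. 6.8 (p. 118); Ch. 7 §2 Definition 7.2 (p. 129), Proposition 7.3
  (pp. 132–134); App. 7A (pp. 234–235).
* [GortzWedhorn2020] U. Görtz, T. Wedhorn, *Algebraic Geometry I*, 2nd ed. (2020), Section (4.7) (pp. 107–108), Prop. 4.16 (p. 101).
* [Lan2013PELCompactifications] K.-W. Lan, *Arithmetic compactifications of PEL-type Shimura varieties* (2013), §1.3.6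
  Lemma 1.3.6.6 and Cor. 1.3.6.7 (pp. 81–82).
* Tree: ★ `AbelianSchemeBaseChangeComp`, ★ `HomFactorsThroughMulNBaseChange`, ★ `LDeltaCubeLocus`, ★
  `PolarizationLevelBaseQuotientDescent`, ★ `PolarizedAbelianSchemeWithLevelBaseChange{,Unique}`, ★
  `AbelianSchemeOverFibreIdentity`, ★ `LevelStructureTransportIso`.
-/

set_option autoImplicit false
set_option backward.isDefEq.respectTransparency false

noncomputable section

universe u

open CategoryTheory CategoryTheory.Limits AlgebraicGeometry MonoidalCategory
open scoped MonObj

namespace Literature.AlgebraicGeometry.AbelianSchemes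

namespace AbelianSchemeOver

/-! ### §1 The comparison `(A ×_S S₁) ×_{S₁} T ≅ A ×_S T` of group schemes over `T` -/

section Comparison

variable {S S₁ T : Scheme.{u}} (A : AbelianSchemeOver S) (j : S₁ ⟶ S) (v : T ⟶ S₁)

/-- `E⁻¹ ≫ E = 𝟙` in `Over T` for the comparison `E = baseChangeCompGrpIso` (an isomorphism of `Grp (Over T)`).
[cite: GortzWedhorn2020, Section (4.7) (pp. 107–108)] -/
theorem baseChangeCompGrpIso_inv_hom_hom_comp_hom :
    (A.baseChangeCompGrpIso j v).inv.hom.hom ≫ (A.baseChangeCompGrpIso j v).hom.hom.hom =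
      𝟙 ((A.baseChange j).baseChange v).X := by
  change ((A.baseChangeCompGrpIso j v).inv ≫ (A.baseChangeCompGrpIso j v).hom).hom.hom = _
  rw [Iso.inv_hom_id]
  rfl

/-- `E ≫ E⁻¹ = 𝟙` in `Over T` for the comparison `E = baseChangeCompGrpIso`. [cite: GortzWedhorn2020, Section (4.7) (pp. 107–108)] -/
theorem baseChangeCompGrpIso_hom_hom_hom_comp_inv :
    (A.baseChangeCompGrpIso j v).hom.hom.hom ≫ (A.baseChangeCompGrpIso j v).inv.hom.hom =
      𝟙 (A.baseChange (v ≫ j)).X := by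
  change ((A.baseChangeCompGrpIso j v).hom ≫ (A.baseChangeCompGrpIso j v).inv).hom.hom = _
  rw [Iso.hom_inv_id]
  rfl

/-- The underlying `T`-morphisms of ★ `baseChangeCompGrpIso` are isomorphisms of `Over T` (inverse direction).
[cite: GortzWedhorn2020, Section (4.7) (pp. 107–108)] -/
theorem isIso_baseChangeCompGrpIso_inv_hom_hom : IsIso (A.baseChangeCompGrpIso j v).inv.hom.hom :=
  ⟨_, A.baseChangeCompGrpIso_inv_hom_hom_comp_hom j v, A.baseChangeCompGrpIso_hom_hom_hom_comp_inv j v⟩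

/-- The underlying `T`-morphisms of ★ `baseChangeCompGrpIso` are isomorphisms of `Over T` (forward direction).
[cite: GortzWedhorn2020, Section (4.7) (pp. 107–108)] -/
theorem isIso_baseChangeCompGrpIso_hom_hom_hom : IsIso (A.baseChangeCompGrpIso j v).hom.hom.hom :=
  ⟨_, A.baseChangeCompGrpIso_hom_hom_hom_comp_inv j v, A.baseChangeCompGrpIso_inv_hom_hom_comp_hom j v⟩

/-- **`(A ×_S S₁) ×_{S₁} T` is the base change of `A ×_S T` along `𝟙 T`** via the comparison isomorphism (an isomorphism
of group schemes over `T`, ★ `isBaseChangeVia_id_of_isMonHom`). [cite: MumfordFogartyKirwan1994, Ch. 7 §2 Definition 7.2 (p. 129)]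
[cite: GortzWedhorn2020, Section (4.7) (pp. 107–108)] -/
theorem baseChange_baseChange_isBaseChangeVia_id :
    ((A.baseChange j).baseChange v).IsBaseChangeVia (A.baseChange (v ≫ j)) (𝟙 T)
      (A.baseChangeCompGrpIso j v).inv.hom.hom.left := by
  haveI := A.isIso_baseChangeCompGrpIso_inv_hom_hom j v
  exact isBaseChangeVia_id_of_isMonHom _ _ _

/-- **`A ×_S T` is the base change of `(A ×_S S₁) ×_{S₁} T` along `𝟙 T`** via the comparison isomorphism.
[cite: MumfordFogartyKirwan1994, Ch. 7 §2 Definition 7.2 (p. 129)] [cite: GortzWedhorn2020, Section (4.7) (pp. 107–108)] -/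
theorem baseChange_comp_isBaseChangeVia_id :
    (A.baseChange (v ≫ j)).IsBaseChangeVia ((A.baseChange j).baseChange v) (𝟙 T)
      (A.baseChangeCompGrpIso j v).hom.hom.hom.left := by
  haveI := A.isIso_baseChangeCompGrpIso_hom_hom_hom j v
  exact isBaseChangeVia_id_of_isMonHom _ _ _

/-- **The pulled-back sections correspond under the comparison isomorphism**: `(τ ×_S S₁) ×_{S₁} T`, read on `A ×_S T`,
is `τ ×_S T` (both are sections of `A ×_S T → T` with the same projection `(v ≫ j) ≫ τ` to `A`).
[cite: MumfordFogartyKirwan1994, Ch. 7 §2 Definition 7.2 (p. 129)] [cite: GortzWedhorn2020, Prop. 4.16 (p. 101)] -/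
theorem sectionBaseChange_sectionBaseChange_comp_baseChangeCompGrpIso_inv (τ : A.Sections) :
    (A.baseChange j).sectionBaseChange v (A.sectionBaseChange j τ) ≫ (A.baseChangeCompGrpIso j v).inv.hom.hom =
      A.sectionBaseChange (v ≫ j) τ := by
  apply Over.OverMorphism.ext
  rw [Over.comp_left]
  have h1 : ((A.baseChange j).sectionBaseChange v (A.sectionBaseChange j τ)).left ≫
      pullback.fst (pullback.snd A.X.hom j) v = v ≫ (A.sectionBaseChange j τ).left :=
    (A.baseChange j).sectionBaseChange_left_comp_fst v (A.sectionBaseChange j τ)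
  have h2 : (A.sectionBaseChange j τ).left ≫ pullback.fst A.X.hom j = j ≫ τ.left :=
    A.sectionBaseChange_left_comp_fst j τ
  have h3 : (A.sectionBaseChange (v ≫ j) τ).left ≫ pullback.fst A.X.hom (v ≫ j) = (v ≫ j) ≫ τ.left :=
    A.sectionBaseChange_left_comp_fst (v ≫ j) τ
  apply pullback.hom_ext
  · rw [Category.assoc, baseChangeCompGrpIso_inv_left_fst, reassoc_of% h1, h2, h3, Category.assoc]
  · rw [Category.assoc, baseChangeCompGrpIso_inv_left_snd]
    exact (Over.w ((A.baseChange j).sectionBaseChange v (A.sectionBaseChange j τ))).trans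
      (Over.w (A.sectionBaseChange (v ≫ j) τ)).symm

/-- The same read the other way: `τ ×_S T`, moved to `(A ×_S S₁) ×_{S₁} T`, is `(τ ×_S S₁) ×_{S₁} T`.
[cite: MumfordFogartyKirwan1994, Ch. 7 §2 Definition 7.2 (p. 129)] [cite: GortzWedhorn2020, Prop. 4.16 (p. 101)] -/
theorem sectionBaseChange_comp_baseChangeCompGrpIso_hom (τ : A.Sections) :
    A.sectionBaseChange (v ≫ j) τ ≫ (A.baseChangeCompGrpIso j v).hom.hom.hom =
      (A.baseChange j).sectionBaseChange v (A.sectionBaseChange j τ) := by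
  rw [← A.sectionBaseChange_sectionBaseChange_comp_baseChangeCompGrpIso_inv j v τ, Category.assoc,
    A.baseChangeCompGrpIso_inv_hom_hom_comp_hom j v]
  exact Category.comp_id _

end Comparison

/-! ### §2 The sixth root of `Λ(L)` base-changes ([MumfordFogartyKirwan1994] Prop. 6.11, uniqueness) -/

section SixthRoot

variable {S S₁ T : Scheme.{u}} (A : AbelianSchemeOver S) (D : A.DualPair) (lam : A.X ⟶ D.hat.X)
  (h6 : ∀ s : S, (6 : S.residueField s) ≠ 0) (j : S₁ ⟶ S) (v : T ⟶ S₁)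
  (pol₁ : (A.baseChange j).Polarization (D.baseChange j))
  (h₁ : ((𝟙 (A.baseChange j).X) ^ 6) ≫ pol₁.lam = (Over.pullback j).map lam)
  (pol : (A.baseChange (v ≫ j)).Polarization (D.baseChange (v ≫ j)))
  (h : ((𝟙 (A.baseChange (v ≫ j)).X) ^ 6) ≫ pol.lam = (Over.pullback (v ≫ j)).map lam)

include h6 h₁ h in
/-- **THE SIXTH ROOT OF `Λ(L)` BASE-CHANGES.**  If `[6] ≫ λ₁ = Λ(L)_{S₁}` over `S₁` and `[6] ≫ λ = Λ(L)_T` over `T`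
(`b = v ≫ j`), then `λ₁ ×_{S₁} T`, transported to `A ×_S T → Â ×_S T` along the comparison isomorphisms
`E : A ×_S T ≅ (A ×_S S₁) ×_{S₁} T`, `Ê`, equals `λ`: the transport is again a sixth root of `Λ(L)_T` (★
`pow_id_comp_transport`) and sixth roots are unique for `6 ∈ 𝒪^×` ([MumfordFogartyKirwan1994] Prop. 6.11, ★
`descended_hom_unique`). [cite: MumfordFogartyKirwan1994, Ch. 6 §2 Prop. 6.11 (p. 122; proof pp. 122–123)]
[cite: GortzWedhorn2020, Section (4.7) (pp. 107–108)] -/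
theorem transport_pullback_map_lam_eq_of_pow_six_comp_eq :
    (A.baseChangeCompGrpIso j v).hom.hom.hom ≫ (Over.pullback v).map pol₁.lam ≫
        (D.hat.baseChangeCompGrpIso j v).inv.hom.hom = pol.lam :=
  A.descended_hom_unique D lam h6 (v ≫ j) _ _ (pow_id_comp_transport lam j v pol₁.lam h₁) h

include h6 h₁ h in
/-- **`(pol₁ ×_{S₁} T).lam = E⁻¹ ≫ pol.lam ≫ Ê`** — the base-changed sixth root read through the comparison
isomorphisms. [cite: MumfordFogartyKirwan1994, Ch. 6 §2 Prop. 6.11 (p. 122; proof pp. 122–123)]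
[cite: GortzWedhorn2020, Section (4.7) (pp. 107–108)] -/
theorem pullback_map_lam_eq_transport_of_pow_six_comp_eq :
    (pol₁.baseChange v).lam = (A.baseChangeCompGrpIso j v).inv.hom.hom ≫ pol.lam ≫
      (D.hat.baseChangeCompGrpIso j v).hom.hom.hom := by
  rw [← A.transport_pullback_map_lam_eq_of_pow_six_comp_eq D lam h6 j v pol₁ h₁ pol h, Category.assoc,
    Category.assoc]
  rw [D.hat.baseChangeCompGrpIso_inv_hom_hom_comp_hom j v, reassoc_of% (A.baseChangeCompGrpIso_inv_hom_hom_comp_hom j v)]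
  exact (Category.comp_id _).symm

include h6 h₁ h in
/-- The `λ`-clause on underlying schemes, direction `(A ×_S S₁) ×_{S₁} T → A ×_S T`:
`(pol₁ ×_{S₁} T).lam ≫ Ê⁻¹ = E⁻¹ ≫ pol.lam` (the `hcomm` input of ★ `Polarization.hasType_of_isBaseChangeVia`).
[cite: MumfordFogartyKirwan1994, Ch. 6 §2 Prop. 6.11 (p. 122; proof pp. 122–123)] -/
theorem baseChange_lam_left_comp_inv_left_of_pow_six_comp_eq :
    (pol₁.baseChange v).lam.left ≫ (D.hat.baseChangeCompGrpIso j v).inv.hom.hom.left =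
      (A.baseChangeCompGrpIso j v).inv.hom.hom.left ≫ pol.lam.left := by
  rw [← Over.comp_left, ← Over.comp_left, A.pullback_map_lam_eq_transport_of_pow_six_comp_eq D lam h6 j v pol₁ h₁
    pol h, Category.assoc, Category.assoc]
  rw [D.hat.baseChangeCompGrpIso_hom_hom_hom_comp_inv j v]
  exact congrArg Over.Hom.left ((A.baseChangeCompGrpIso j v).inv.hom.hom ≫= Category.comp_id pol.lam)

include h6 h₁ h in
/-- The `λ`-clause on underlying schemes, direction `A ×_S T → (A ×_S S₁) ×_{S₁} T`:
`pol.lam ≫ Ê = E ≫ (pol₁ ×_{S₁} T).lam`. [cite: MumfordFogartyKirwan1994, Ch. 6 §2 Prop. 6.11 (p. 122; proof pp. 122–123)] -/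
theorem lam_left_comp_hom_left_of_pow_six_comp_eq :
    pol.lam.left ≫ (D.hat.baseChangeCompGrpIso j v).hom.hom.hom.left =
      (A.baseChangeCompGrpIso j v).hom.hom.hom.left ≫ (pol₁.baseChange v).lam.left := by
  rw [← Over.comp_left, ← Over.comp_left, A.pullback_map_lam_eq_transport_of_pow_six_comp_eq D lam h6 j v pol₁ h₁
    pol h]
  rw [reassoc_of% (A.baseChangeCompGrpIso_hom_hom_hom_comp_inv j v)]

end SixthRoot

/-! ### §3 The Poincaré clause of the comparison isomorphisms -/

section Poincare

/-- Poincaré clauses of two base changes along the same map compare along a morphism `(H, Ĥ)` over `𝟙 T` commuting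
with the comparison maps (the Poincaré bullet of ★ `IsBaseChangeVia.exists_isBaseChangeVia_id_of_isBaseChangeVia`, for
bare dual pairs): `(H, Ĥ)^* 𝒫₁ ≅ (H, Ĥ)^* (G₁, Ĝ₁)^* 𝒫 ≅ (G₂, Ĝ₂)^* 𝒫 ≅ 𝒫₂`. [cite: MumfordFogartyKirwan1994, Ch. 7 §2 Definition 7.2 (p. 129)]
[cite: GortzWedhorn2020, Prop. 4.16 (p. 101)] -/
theorem DualPair.nonempty_pullback_map_iso_of_comp_eq {S T : Scheme.{u}} {A : AbelianSchemeOver S}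
    {A₁ A₂ : AbelianSchemeOver T} (D : A.DualPair) (D₁ : A₁.DualPair) (D₂ : A₂.DualPair) {f : T ⟶ S}
    {G₁ : A₁.X.left ⟶ A.X.left} {Ĝ₁ : D₁.hat.X.left ⟶ D.hat.X.left}
    {G₂ : A₂.X.left ⟶ A.X.left} {Ĝ₂ : D₂.hat.X.left ⟶ D.hat.X.left}
    (wG₁ : A₁.X.hom ≫ f = G₁ ≫ A.X.hom) (wĜ₁ : D₁.hat.X.hom ≫ f = Ĝ₁ ≫ D.hat.X.hom)
    (wG₂ : A₂.X.hom ≫ f = G₂ ≫ A.X.hom) (wĜ₂ : D₂.hat.X.hom ≫ f = Ĝ₂ ≫ D.hat.X.hom)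
    (e₁ : (Scheme.Modules.pullback
      (pullback.map A₁.X.hom D₁.hat.X.hom A.X.hom D.hat.X.hom G₁ Ĝ₁ f wG₁ wĜ₁)).obj D.P ≅ D₁.P)
    (e₂ : (Scheme.Modules.pullback
      (pullback.map A₂.X.hom D₂.hat.X.hom A.X.hom D.hat.X.hom G₂ Ĝ₂ f wG₂ wĜ₂)).obj D.P ≅ D₂.P)
    {H : A₂.X.left ⟶ A₁.X.left} {Ĥ : D₂.hat.X.left ⟶ D₁.hat.X.left} (hHG : H ≫ G₁ = G₂) (hĤG : Ĥ ≫ Ĝ₁ = Ĝ₂)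
    (wH : A₂.X.hom ≫ 𝟙 T = H ≫ A₁.X.hom) (wĤ : D₂.hat.X.hom ≫ 𝟙 T = Ĥ ≫ D₁.hat.X.hom) :
    Nonempty ((Scheme.Modules.pullback
      (pullback.map A₂.X.hom D₂.hat.X.hom A₁.X.hom D₁.hat.X.hom H Ĥ (𝟙 T) wH wĤ)).obj D₁.P ≅ D₂.P) := by
  have hcomp : pullback.map A₂.X.hom D₂.hat.X.hom A₁.X.hom D₁.hat.X.hom H Ĥ (𝟙 T) wH wĤ ≫
        pullback.map A₁.X.hom D₁.hat.X.hom A.X.hom D.hat.X.hom G₁ Ĝ₁ f wG₁ wĜ₁ =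
      pullback.map A₂.X.hom D₂.hat.X.hom A.X.hom D.hat.X.hom G₂ Ĝ₂ f wG₂ wĜ₂ := by
    apply pullback.hom_ext
    · rw [Category.assoc, pullback.lift_fst, ← Category.assoc, pullback.lift_fst, Category.assoc, hHG,
        pullback.lift_fst]
    · rw [Category.assoc, pullback.lift_snd, ← Category.assoc, pullback.lift_snd, Category.assoc, hĤG,
        pullback.lift_snd]
  exact ⟨(Scheme.Modules.pullback
      (pullback.map A₂.X.hom D₂.hat.X.hom A₁.X.hom D₁.hat.X.hom H Ĥ (𝟙 T) wH wĤ)).mapIso e₁.symm ≪≫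
    (Scheme.Modules.pullbackComp
      (pullback.map A₂.X.hom D₂.hat.X.hom A₁.X.hom D₁.hat.X.hom H Ĥ (𝟙 T) wH wĤ)
      (pullback.map A₁.X.hom D₁.hat.X.hom A.X.hom D.hat.X.hom G₁ Ĝ₁ f wG₁ wĜ₁)).app D.P ≪≫
    (Scheme.Modules.pullbackCongr hcomp).app D.P ≪≫ e₂⟩

variable {S S₁ T : Scheme.{u}} (A : AbelianSchemeOver S) (D : A.DualPair) (j : S₁ ⟶ S) (v : T ⟶ S₁)

/-- `π_{(A_{S₁})_T} ≫ v ≫ j = (pr ≫ pr) ≫ π_A` (the two cartesian squares pasted). [cite: GortzWedhorn2020, Section (4.7) (pp. 107–108)] -/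
private theorem baseChange_baseChange_hom_comp :
    ((A.baseChange j).baseChange v).X.hom ≫ (v ≫ j) =
      (pullback.fst (pullback.snd A.X.hom j) v ≫ pullback.fst A.X.hom j) ≫ A.X.hom := by
  change pullback.snd (pullback.snd A.X.hom j) v ≫ v ≫ j = _
  rw [← pullback.condition_assoc, Category.assoc, ← pullback.condition]

/-- **The Poincaré clause of the double base change**: `(pr ≫ pr, p̂r ≫ p̂r)^* 𝒫 ≅ (𝒫_{S₁})_T` on
`((A ×_S S₁) ×_{S₁} T) ×_T ((Â ×_S S₁) ×_{S₁} T)`. [cite: MumfordFogartyKirwan1994, Ch. 7 §2 Definition 7.2 (p. 129)]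
[cite: MumfordFogartyKirwan1994, Ch. 6 §1 Cor. 6.8 (p. 118)] -/
theorem DualPair.nonempty_pullback_map_P_iso_baseChange_baseChange_P :
    Nonempty ((Scheme.Modules.pullback (pullback.map ((A.baseChange j).baseChange v).X.hom
      ((D.baseChange j).baseChange v).hat.X.hom A.X.hom D.hat.X.hom
      (pullback.fst (pullback.snd A.X.hom j) v ≫ pullback.fst A.X.hom j)
      (pullback.fst (pullback.snd D.hat.X.hom j) v ≫ pullback.fst D.hat.X.hom j) (v ≫ j)
      (A.baseChange_baseChange_hom_comp j v) (D.hat.baseChange_baseChange_hom_comp j v))).obj D.P ≅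
        ((D.baseChange j).baseChange v).P) := by
  have wAj : (A.baseChange j).X.hom ≫ j = pullback.fst A.X.hom j ≫ A.X.hom := pullback.condition.symm
  have wHj : (D.baseChange j).hat.X.hom ≫ j = pullback.fst D.hat.X.hom j ≫ D.hat.X.hom := pullback.condition.symm
  have wAv : ((A.baseChange j).baseChange v).X.hom ≫ v = pullback.fst (A.baseChange j).X.hom v ≫ (A.baseChange j).X.hom :=
    pullback.condition.symm
  have wHv : ((D.baseChange j).baseChange v).hat.X.hom ≫ v =
      pullback.fst (D.baseChange j).hat.X.hom v ≫ (D.baseChange j).hat.X.hom := pullback.condition.symm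
  exact DualPair.nonempty_pullback_map_comp_iso D (D.baseChange j) ((D.baseChange j).baseChange v) wAj wHj wAv wHv
    (D.nonempty_pullback_map_P_iso_baseChange_P j wAj wHj)
    ((D.baseChange j).nonempty_pullback_map_P_iso_baseChange_P v wAv wHv) _ _

/-- **The Poincaré clause of `(E⁻¹, Ê⁻¹) : (A ×_S S₁) ×_{S₁} T → A ×_S T`**: `(E⁻¹ × Ê⁻¹)^* 𝒫_T ≅ (𝒫_{S₁})_T` (the `eP`
input of ★ `LevelStructure.isSymplecticLiftable_of_isBaseChangeVia` in this direction).
[cite: MumfordFogartyKirwan1994, Ch. 7 §2 Definition 7.2 (p. 129)] [cite: GortzWedhorn2020, Prop. 4.16 (p. 101)] -/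
theorem DualPair.nonempty_pullback_map_inv_P_iso
    (wH : ((A.baseChange j).baseChange v).X.hom ≫ 𝟙 T =
      (A.baseChangeCompGrpIso j v).inv.hom.hom.left ≫ (A.baseChange (v ≫ j)).X.hom)
    (wĤ : ((D.baseChange j).baseChange v).hat.X.hom ≫ 𝟙 T =
      (D.hat.baseChangeCompGrpIso j v).inv.hom.hom.left ≫ (D.baseChange (v ≫ j)).hat.X.hom) :
    Nonempty ((Scheme.Modules.pullback (pullback.map ((A.baseChange j).baseChange v).X.hom
      ((D.baseChange j).baseChange v).hat.X.hom (A.baseChange (v ≫ j)).X.hom (D.baseChange (v ≫ j)).hat.X.hom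
      (A.baseChangeCompGrpIso j v).inv.hom.hom.left (D.hat.baseChangeCompGrpIso j v).inv.hom.hom.left (𝟙 T)
      wH wĤ)).obj (D.baseChange (v ≫ j)).P ≅ ((D.baseChange j).baseChange v).P) := by
  have wAb : (A.baseChange (v ≫ j)).X.hom ≫ (v ≫ j) = pullback.fst A.X.hom (v ≫ j) ≫ A.X.hom :=
    pullback.condition.symm
  have wHb : (D.baseChange (v ≫ j)).hat.X.hom ≫ (v ≫ j) = pullback.fst D.hat.X.hom (v ≫ j) ≫ D.hat.X.hom :=
    pullback.condition.symm
  obtain ⟨eb⟩ := D.nonempty_pullback_map_P_iso_baseChange_P (v ≫ j) wAb wHb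
  obtain ⟨e₂⟩ := DualPair.nonempty_pullback_map_P_iso_baseChange_baseChange_P A D j v
  exact DualPair.nonempty_pullback_map_iso_of_comp_eq D (D.baseChange (v ≫ j)) ((D.baseChange j).baseChange v)
    wAb wHb _ _ eb e₂ (A.baseChangeCompGrpIso_inv_left_fst j v) (D.hat.baseChangeCompGrpIso_inv_left_fst j v) wH wĤ

/-- **The Poincaré clause of `(E, Ê) : A ×_S T → (A ×_S S₁) ×_{S₁} T`**: `(E × Ê)^* (𝒫_{S₁})_T ≅ 𝒫_T`.
[cite: MumfordFogartyKirwan1994, Ch. 7 §2 Definition 7.2 (p. 129)] [cite: GortzWedhorn2020, Prop. 4.16 (p. 101)] -/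
theorem DualPair.nonempty_pullback_map_hom_P_iso
    (wH : (A.baseChange (v ≫ j)).X.hom ≫ 𝟙 T =
      (A.baseChangeCompGrpIso j v).hom.hom.hom.left ≫ ((A.baseChange j).baseChange v).X.hom)
    (wĤ : (D.baseChange (v ≫ j)).hat.X.hom ≫ 𝟙 T =
      (D.hat.baseChangeCompGrpIso j v).hom.hom.hom.left ≫ ((D.baseChange j).baseChange v).hat.X.hom) :
    Nonempty ((Scheme.Modules.pullback (pullback.map (A.baseChange (v ≫ j)).X.hom (D.baseChange (v ≫ j)).hat.X.hom
      ((A.baseChange j).baseChange v).X.hom ((D.baseChange j).baseChange v).hat.X.hom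
      (A.baseChangeCompGrpIso j v).hom.hom.hom.left (D.hat.baseChangeCompGrpIso j v).hom.hom.hom.left (𝟙 T)
      wH wĤ)).obj ((D.baseChange j).baseChange v).P ≅ (D.baseChange (v ≫ j)).P) := by
  have wAb : (A.baseChange (v ≫ j)).X.hom ≫ (v ≫ j) = pullback.fst A.X.hom (v ≫ j) ≫ A.X.hom :=
    pullback.condition.symm
  have wHb : (D.baseChange (v ≫ j)).hat.X.hom ≫ (v ≫ j) = pullback.fst D.hat.X.hom (v ≫ j) ≫ D.hat.X.hom :=
    pullback.condition.symm
  obtain ⟨eb⟩ := D.nonempty_pullback_map_P_iso_baseChange_P (v ≫ j) wAb wHb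
  obtain ⟨e₂⟩ := DualPair.nonempty_pullback_map_P_iso_baseChange_baseChange_P A D j v
  exact DualPair.nonempty_pullback_map_iso_of_comp_eq D ((D.baseChange j).baseChange v) (D.baseChange (v ≫ j))
    _ _ wAb wHb e₂ eb (A.baseChangeCompGrpIso_hom_left_fst_fst j v)
    (D.hat.baseChangeCompGrpIso_hom_left_fst_fst j v) wH wĤ

end Poincare

/-! ### §4 The clauses of [MumfordFogartyKirwan1994] Prop. 7.3 agree on `(A ×_S S₁) ×_{S₁} T` and on `A ×_S T` -/

section Clauses

variable {S S₁ T : Scheme.{u}} (A : AbelianSchemeOver S) (D : A.DualPair) (lam : A.X ⟶ D.hat.X)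
  (h6 : ∀ s : S, (6 : S.residueField s) ≠ 0) {j : S₁ ⟶ S} {v : T ⟶ S₁} {b : T ⟶ S} (hb : v ≫ j = b)
  (pol₁ : (A.baseChange j).Polarization (D.baseChange j))
  (h₁ : ((𝟙 (A.baseChange j).X) ^ 6) ≫ pol₁.lam = (Over.pullback j).map lam)
  (pol : (A.baseChange b).Polarization (D.baseChange b))
  (h : ((𝟙 (A.baseChange b).X) ^ 6) ≫ pol.lam = (Over.pullback b).map lam)
  {g₀ N : ℕ} (δ : Fin g₀ → ℕ) (σ : Fin g₀ ⊕ Fin g₀ → A.Sections)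

include h6 hb h₁ h in
/-- **THE TYPE CLAUSE AGREES.**  For `b = v ≫ j` and sixth roots `pol₁.lam` of `Λ(L)_{S₁}`, `pol.lam` of `Λ(L)_T`:
`pol₁ ×_{S₁} T` has type `δ` iff `pol` has (★ `Polarization.hasType_of_isBaseChangeVia` along `𝟙 T`, both ways, for
the comparison isomorphisms of §1 and the `λ`-clause of §2). [cite: MumfordFogartyKirwan1994, App. 7A (pp. 234–235)]
[cite: MumfordFogartyKirwan1994, Ch. 6 §2 Prop. 6.11 (p. 122; proof pp. 122–123)] -/
theorem Polarization.hasType_baseChange_iff_of_pow_six_comp_eq :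
    (pol₁.baseChange v).HasType δ ↔ pol.HasType δ := by
  subst hb
  constructor
  · exact fun hT => Polarization.hasType_of_isBaseChangeVia (A.baseChange_baseChange_isBaseChangeVia_id j v)
      ((D.baseChange j).baseChange v) (D.baseChange (v ≫ j)) (D.hat.baseChange_baseChange_isBaseChangeVia_id j v)
      (pol₁.baseChange v) pol (A.baseChange_lam_left_comp_inv_left_of_pow_six_comp_eq D lam h6 j v pol₁ h₁ pol h) hT
  · exact fun hT => Polarization.hasType_of_isBaseChangeVia (A.baseChange_comp_isBaseChangeVia_id j v)
      (D.baseChange (v ≫ j)) ((D.baseChange j).baseChange v) (D.hat.baseChange_comp_isBaseChangeVia_id j v)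
      pol (pol₁.baseChange v) (A.lam_left_comp_hom_left_of_pow_six_comp_eq D lam h6 j v pol₁ h₁ pol h) hT

include h6 hb h₁ h in
/-- **THE SYMPLECTIC-LIFTABILITY CLAUSE AGREES** for level structures whose sections are the pulled-back `σᵢ`:
`φ₁` on `(A ×_S S₁) ×_{S₁} T` (sections `(σᵢ ×_S S₁) ×_{S₁} T`) is symplectic-liftable of type `δ` for `pol₁ ×_{S₁} T`
iff `φ` on `A ×_S T` (sections `σᵢ ×_S T`) is for `pol` (★ `LevelStructure.isSymplecticLiftable_of_isBaseChangeVia`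
along `𝟙 T`, both ways: §1 sections, §2 `λ`-clause, §3 Poincaré clause).
[cite: Lan2013PELCompactifications, §1.3.6 Lemma 1.3.6.6 and Cor. 1.3.6.7 (pp. 81–82)]
[cite: MumfordFogartyKirwan1994, Ch. 7 §2 Definition 7.2 (p. 129)] -/
theorem LevelStructure.isSymplecticLiftable_iff_of_pow_six_comp_eq
    (φ₁ : LevelStructure g₀ N ((A.baseChange j).baseChange v)) (φ : LevelStructure g₀ N (A.baseChange b))
    (hφ₁ : ∀ i, φ₁.σ i = (A.baseChange j).sectionBaseChange v (A.sectionBaseChange j (σ i)))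
    (hφ : ∀ i, φ.σ i = A.sectionBaseChange b (σ i)) :
    φ₁.IsSymplecticLiftable (pol₁.baseChange v) δ ↔ φ.IsSymplecticLiftable pol δ := by
  subst hb
  have hστ : ∀ i, (φ₁.σ i).left ≫ (A.baseChangeCompGrpIso j v).inv.hom.hom.left = 𝟙 T ≫ (φ.σ i).left := fun i => by
    rw [hφ₁, hφ, Category.id_comp, ← Over.comp_left,
      A.sectionBaseChange_sectionBaseChange_comp_baseChangeCompGrpIso_inv j v (σ i)]
  have hτσ : ∀ i, (φ.σ i).left ≫ (A.baseChangeCompGrpIso j v).hom.hom.hom.left = 𝟙 T ≫ (φ₁.σ i).left := fun i => by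
    rw [hφ₁, hφ, Category.id_comp, ← Over.comp_left, A.sectionBaseChange_comp_baseChangeCompGrpIso_hom j v (σ i)]
  constructor
  · intro hL
    exact LevelStructure.isSymplecticLiftable_of_isBaseChangeVia (A.baseChange_baseChange_isBaseChangeVia_id j v)
      ((D.baseChange j).baseChange v) (D.baseChange (v ≫ j)) (D.hat.baseChange_baseChange_isBaseChangeVia_id j v)
      φ₁ φ hστ (pol₁.baseChange v) pol
      (A.baseChange_lam_left_comp_inv_left_of_pow_six_comp_eq D lam h6 j v pol₁ h₁ pol h)
      (DualPair.nonempty_pullback_map_inv_P_iso A D j v _ _) δ hL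
  · intro hL
    exact LevelStructure.isSymplecticLiftable_of_isBaseChangeVia (A.baseChange_comp_isBaseChangeVia_id j v)
      (D.baseChange (v ≫ j)) ((D.baseChange j).baseChange v) (D.hat.baseChange_comp_isBaseChangeVia_id j v)
      φ φ₁ hτσ pol (pol₁.baseChange v)
      (A.lam_left_comp_hom_left_of_pow_six_comp_eq D lam h6 j v pol₁ h₁ pol h)
      (DualPair.nonempty_pullback_map_hom_P_iso A D j v _ _) δ hL

include hb in
/-- **THE LEVEL CLAUSE AGREES**: the sections `(σᵢ ×_S S₁) ×_{S₁} T` are those of a level-`N` structure on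
`(A ×_S S₁) ×_{S₁} T` iff the sections `σᵢ ×_S T` are those of a level-`N` structure on `A ×_S T` (level structures
move along the isomorphism of group schemes `E`, ★ `LevelStructure.exists_comp_of_iso`, and `E` matches the sections,
§1). [cite: MumfordFogartyKirwan1994, Ch. 7 §2 Definitions 7.1 and 7.2 (p. 129)] [cite: GortzWedhorn2020, Section (4.7) (pp. 107–108)] -/
theorem LevelStructure.exists_baseChange_baseChange_iff :
    (∃ φ₁ : LevelStructure g₀ N ((A.baseChange j).baseChange v),
        ∀ i, φ₁.σ i = (A.baseChange j).sectionBaseChange v (A.sectionBaseChange j (σ i))) ↔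
      ∃ φ : LevelStructure g₀ N (A.baseChange b), ∀ i, φ.σ i = A.sectionBaseChange b (σ i) := by
  subst hb
  haveI := A.isIso_baseChangeCompGrpIso_inv_hom_hom j v
  haveI := A.isIso_baseChangeCompGrpIso_hom_hom_hom j v
  constructor
  · rintro ⟨φ₁, hφ₁⟩
    haveI : IsMonHom (asIso (A.baseChangeCompGrpIso j v).inv.hom.hom).hom := by
      change IsMonHom (A.baseChangeCompGrpIso j v).inv.hom.hom
      infer_instance
    obtain ⟨φ, hφ⟩ := LevelStructure.exists_comp_of_iso (asIso (A.baseChangeCompGrpIso j v).inv.hom.hom) φ₁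
    refine ⟨φ, fun i => ?_⟩
    rw [hφ i, hφ₁ i]
    exact A.sectionBaseChange_sectionBaseChange_comp_baseChangeCompGrpIso_inv j v (σ i)
  · rintro ⟨φ, hφ⟩
    haveI : IsMonHom (asIso (A.baseChangeCompGrpIso j v).hom.hom.hom).hom := by
      change IsMonHom (A.baseChangeCompGrpIso j v).hom.hom.hom
      infer_instance
    obtain ⟨φ₁, hφ₁⟩ := LevelStructure.exists_comp_of_iso (asIso (A.baseChangeCompGrpIso j v).hom.hom.hom) φ
    refine ⟨φ₁, fun i => ?_⟩
    rw [hφ₁ i, hφ i]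
    exact A.sectionBaseChange_comp_baseChangeCompGrpIso_hom j v (σ i)

include h6 hb h₁ h in
/-- **THE LEVEL-AND-LIFTABILITY CLAUSE AGREES**: «the `(σᵢ ×_S S₁) ×_{S₁} T` form a level-`N` structure on
`(A ×_S S₁) ×_{S₁} T`, symplectic-liftable of type `δ` for `pol₁ ×_{S₁} T`» iff «the `σᵢ ×_S T` form a level-`N` structure
on `A ×_S T`, symplectic-liftable of type `δ` for `pol`» (the two previous statements).
[cite: MumfordFogartyKirwan1994, Ch. 7 §2 Definition 7.2 (p. 129) and Proposition 7.3 (pp. 132–134)]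
[cite: Lan2013PELCompactifications, §1.3.6 Lemma 1.3.6.6 and Cor. 1.3.6.7 (pp. 81–82)] -/
theorem LevelStructure.exists_isSymplecticLiftable_iff_of_pow_six_comp_eq :
    (∃ φ₁ : LevelStructure g₀ N ((A.baseChange j).baseChange v),
        (∀ i, φ₁.σ i = (A.baseChange j).sectionBaseChange v (A.sectionBaseChange j (σ i))) ∧
          φ₁.IsSymplecticLiftable (pol₁.baseChange v) δ) ↔
      ∃ φ : LevelStructure g₀ N (A.baseChange b), (∀ i, φ.σ i = A.sectionBaseChange b (σ i)) ∧
        φ.IsSymplecticLiftable pol δ := by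
  constructor
  · rintro ⟨φ₁, hφ₁, hL⟩
    obtain ⟨φ, hφ⟩ := (LevelStructure.exists_baseChange_baseChange_iff A hb (g₀ := g₀) (N := N) σ).1 ⟨φ₁, hφ₁⟩
    exact ⟨φ, hφ,
      (LevelStructure.isSymplecticLiftable_iff_of_pow_six_comp_eq A D lam h6 hb pol₁ h₁ pol h δ σ φ₁ φ hφ₁ hφ).1 hL⟩
  · rintro ⟨φ, hφ, hL⟩
    obtain ⟨φ₁, hφ₁⟩ := (LevelStructure.exists_baseChange_baseChange_iff A hb (g₀ := g₀) (N := N) σ).2 ⟨φ, hφ⟩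
    exact ⟨φ₁, hφ₁,
      (LevelStructure.isSymplecticLiftable_iff_of_pow_six_comp_eq A D lam h6 hb pol₁ h₁ pol h δ σ φ₁ φ hφ₁ hφ).2 hL⟩

include h6 hb h₁ h in
/-- **HEAD — THE CLAUSES OF [MumfordFogartyKirwan1994] Prop. 7.3 AGREE ON `(A ×_S S₁) ×_{S₁} T` AND ON `A ×_S T`** (the
(S2) letter of the capstone ★/HOME `MFKTowerOfAbelianScheme`, hypothesis `hS2`).  For `b = v ≫ j`, polarisations `pol₁` of
`(A, D) ×_S S₁` and `pol` of `(A, D) ×_S T` that are sixth roots of `Λ(L)` (`[6] ≫ pol₁.lam = Λ(L)_{S₁}`,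
`[6] ≫ pol.lam = Λ(L)_T`), a polarisation type `δ`, a level `N` and `2g` sections `σᵢ ∈ A(S)`: (i) `pol₁ ×_{S₁} T` has type
`δ` iff `pol` has; (ii) the `(σᵢ ×_S S₁) ×_{S₁} T` form a level-`N` structure symplectic-liftable of type `δ` for
`pol₁ ×_{S₁} T` iff the `σᵢ ×_S T` form one for `pol`.  (The sixth root is unique, [MumfordFogartyKirwan1994] Prop. 6.11,
so the two triples are isomorphic over `T`; the clauses are invariant under isomorphism of triples, Def. 7.2.)
[cite: MumfordFogartyKirwan1994, Ch. 7 §2 Definition 7.2 (p. 129) and Proposition 7.3 (pp. 132–134)]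
[cite: MumfordFogartyKirwan1994, Ch. 6 §2 Prop. 6.11 (p. 122; proof pp. 122–123)]
[cite: Lan2013PELCompactifications, §1.3.6 Lemma 1.3.6.6 and Cor. 1.3.6.7 (pp. 81–82)] -/
theorem hasType_iff_and_exists_isSymplecticLiftable_iff_of_pow_six_comp_eq :
    ((pol₁.baseChange v).HasType δ ↔ pol.HasType δ) ∧
      ((∃ φ₁ : LevelStructure g₀ N ((A.baseChange j).baseChange v),
          (∀ i, φ₁.σ i = (A.baseChange j).sectionBaseChange v (A.sectionBaseChange j (σ i))) ∧
            φ₁.IsSymplecticLiftable (pol₁.baseChange v) δ) ↔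
        ∃ φ : LevelStructure g₀ N (A.baseChange b),
          (∀ i, φ.σ i = A.sectionBaseChange b (σ i)) ∧ φ.IsSymplecticLiftable pol δ) :=
  ⟨Polarization.hasType_baseChange_iff_of_pow_six_comp_eq A D lam h6 hb pol₁ h₁ pol h δ,
    LevelStructure.exists_isSymplecticLiftable_iff_of_pow_six_comp_eq A D lam h6 hb pol₁ h₁ pol h δ σ⟩

end Clauses

end AbelianSchemeOver

end Literature.AlgebraicGeometry.AbelianSchemes

end
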